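import Summits.BirchSwinnertonDyer.BirchSwinnertonDyer.Theorems.QuadraticBranchSignedControlPlusEtaLowerInclusionTamagawaRoadMordellWeil
import Summits.BirchSwinnertonDyer.BirchSwinnertonDyer.Theorems.Rank1ResidualX11RankOneMinimality
import Summits.BirchSwinnertonDyer.Rank1Residual.Additive.IntModelTamagawaCertificate
import HarnessLib

/-!
# Route `QuadraticBranchSignedControl` (rung K8, cell `bsd-potss`), crux `PlusEtaLowerInclusion`
# (item stmt-BirchSwinnertonDyer-19601): the RANK-ONE MORDELL–WEIL-DIVISIBLE ROWS, part 01 — the record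
# shape of the Tamagawa road WITH the Mordell–Weil classes, and (E⁺_η) ∧ (C1⁺_η) at `p = 7` for every
# tower-onto good supersingular twist of `499800hw1`, its Tamagawa-`7` prime CERTIFIED IN THE KERNEL
# (seat `bsd-potss-k8eta-c1` g5; `--supports` 19601)

WHAT. g3's census (HOME/k8eta-c1/ETALEAD-TABLE-k8eta-c1-g3.tsv) left four rank-one tower-onto rows of
crux 19601 out of reach of g4's Tamagawa road (`v + k·r ≤ ∑_T ord_p c_ℓ(W)`): among them `499800hw1`@7
(ONE Tamagawa-`7` prime `c₃ = 7`, `∑ = 1 = r`, `v_an = 1`). The road WITH the Mordell–Weil classes (this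
seat: `…TamagawaRoadMordellWeilBrick` / `…Count` / `…MordellWeil`) reads **`v ≤ ∑_T ord_p c_ℓ(W)`** — no
rank term — once every rational point of `W` is `p`-divisible in `W(ℚ_ℓ)` at each `ℓ ∈ T` (`hdivT`).
* §1 `etaPair_of_rowCheck_of_mordellWeilDivisible` — RECORD SHAPE: the named facts + `hPT` + `p ≥ 5` + a
  PASSING Tate ROW CERTIFICATE of the integer equation `W₀` with a list `L` of listed primes `≠ p`
  carrying exact values `c` with `p ∥ c` (every other listed prime `≠ p` prime to `p`; all `decide`-able)
  + the DISPLAYED `T`-local divisibility of `W(ℚ)` at level `p` on `T = pl(L)` + the `V`-side inputs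
  (tower onto, `V`-certificate, analytic certificate `p^{|L|+1} ∤ coeff_r L_p⁺(V,η,T)`) ⟹
  (E⁺_η)(V,p) ∧ (C1⁺_η)(V,p). NO rank hypothesis (g4's shape `etaPair_of_rowCheck_of_tamagawaPair`
  displayed `rank W(ℚ) ≤ 1` and needed TWO Tamagawa primes).
* §2 the row `499800hw1`@7: kernel row certificate `rowCheck_v499800hw1` (`2`: II* `c = 1`; `3`: I₇ SPLIT
  `c = 7`; `5`: II `c = 1`; `7`: I₀* `c ∈ {1,2,4}`; `17`: I₃ non-split `c = 1`; engine `tam.py` sha16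
  27accf42683dbafd unmodified, = PARI), global minimality (bounded Kraus), and `etaPair_r1_v499800hw1_7`.
EVIDENCE for `hdivT` on this row (kit j275435, Sage 10.9: `E.gens()` + `saturation`, DISPLAYED, not
kernel): `W(ℚ) ≅ ℤ` (torsion trivial, `r_an = 1`), generator `P` of height `4.359…`, `7`-saturated, and
`P` reduces to a NON-SINGULAR point of the minimal model mod `3` (component order `1` in `Φ₃ ≅ ℤ/7`); as
`W⁰(ℚ₃)/W¹(ℚ₃) ≅ 𝔽₃^×` (split I₇) and `W¹(ℚ₃)` is pro-`3`, `W⁰(ℚ₃)` is uniquely `7`-divisible, so every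
point of `W(ℚ) = ℤP ⊂ W⁰(ℚ₃)` is `7`-divisible in `W(ℚ₃)`. By contrast, on the 13 Tamagawa-`5` rows of g4
(p517668 / p518013 / p518272) the generator has component order `5` at both Tamagawa primes (same job):
`hdivT` fails there, consistent with `v_an = 1 = ∑ − 1`.

HONEST LABEL (cell `bsd-potss`, HUMAN RULING D-0036/D-0074/D-0088(2)): the row theorem is CONDITIONAL on
NAMED facts in hypothesis position (Kobayashi 2003 Thm. 1.2/1.3/2.2η/4.1η, Kitajima–Otsuki 2018 Thm. 1.3
at `η`, Poitou–Tate = Milne I.4.10) and on DISPLAYED per-pair inputs: the `T`-local divisibility `hdivT`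
(evidence above), and on the twist `V`: `ρ_{V,7^m}` onto for all `m`, the `V`-certificate, and the
ANALYTIC certificate `49 ∤ coeff₁ L_7⁺(V,η,T)` (g3's kit census: `v_an = 1`; EVIDENCE tier, kernel for NO
row). IN THE KERNEL: `Δ ≠ 0`, global minimality, the complete local Tamagawa data of `W` at every bad
prime. A PER-ROW INSTANCE; the class-wide crux 19601 is OPEN and NOT closed; nothing is booked;
`BSD(W,7)` is claimed for no row. No `sorry`, no definition, axioms standard. r1 tally of the census with this row:
18/21 (4 λ-rows + 13 Tamagawa rows + `499800hw1`); residue `69150v1` (`v_an = 2`; generator OFF the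
identity component), `232050cw1`, `418950b1` (Tamagawa-free height-defect rows).

References: [Kobayashi2003] §4 Even MC + Thm. 4.1 (p. 8), Thm. 2.2 (p. 5); [KitajimaOtsuki2018] Thm. 1.3;
[MilneADT2006] I Thm. 4.10; [SilvermanATAEC1994] IV.9.4; [SilvermanAEC2009] VII.2.1, VII.6.1; [Cremona1997]
Table 1; [Kraus1989].
-/

set_option autoImplicit false
set_option linter.dupNamespace false

noncomputable section

open scoped Classical

open CongruenceSubgroup WeierstrassCurve NumberField IsDedekindDomain
open Literature.NumberTheory.EllipticCurves
open Literature.NumberTheory.EllipticCurves.ModularForms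
open Literature.NumberTheory.GaloisRepresentations
open Literature.NumberTheory.GaloisCohomology
open Summit.BirchSwinnertonDyer.Rank1Residual.Additive
open Summit.BirchSwinnertonDyer.BirchSwinnertonDyer.Rank2Observatory.Tam
open Summit.BirchSwinnertonDyer.BirchSwinnertonDyer.Rank1Residual.X11RankOne

namespace Summit.BirchSwinnertonDyer.BirchSwinnertonDyer.Theorems

/-! ## §1 The record shape of the road with the Mordell–Weil classes -/

section Shape

variable {p : ℕ} [hp : Fact p.Prime]

/-- **RECORD SHAPE — (E⁺_η) ∧ (C1⁺_η) on a Mordell–Weil-divisible Tamagawa row.** GRANTED the named facts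
(Kobayashi 1.2/1.3/2.2η/4.1η, Kitajima–Otsuki 1.3η, Poitou–Tate), `p ≥ 5`, an integer equation `W₀` with
a PASSING ROW CERTIFICATE `Es` and a list `L` of listed primes `≠ p` carrying the exact certified values
`c` with `p ∥ c`, every other listed prime `≠ p` having certified values prime to `p` (all
`decide`-able), `W = W₀ ⊗ ℚ` globally minimal whose rational points are `p`-DIVISIBLE in `W(ℚ_w)` at every
`w ∈ pl(L)` (DISPLAYED): for every globally minimal `V` with `C • W^{(p*)} = V`, good at `p`, `a_p(V) = 0`,
`ρ_{V,p^m}` onto, the `V`-certificate and the ANALYTIC certificate `p^{|L|+1} ∤ coeff_r L_p⁺(V,η,T)`: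
**(E⁺_η)(V,p) ∧ (C1⁺_η)(V,p)** (`…TamagawaRoadMordellWeil` §7 with `T = pl(L)`, `m = 1`, `v = |L| = ∑_T
ord_p c_w`). NO rank hypothesis. CONDITIONAL; closes nothing class-wide.
[cite: Kobayashi2003, Thm. 2.2 (p. 5), §4 Even main conjecture and Thm. 4.1 (p. 8)]
[cite: KitajimaOtsuki2018, Thm. 1.3] [cite: MilneADT2006, Ch. I, Thm. 4.10] [cite: SilvermanATAEC1994, IV.9.4] -/
theorem etaPair_of_rowCheck_of_mordellWeilDivisible
    (h12 : Kobayashi2003.thm12_signedSelmerDual_finite_torsion)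
    (h13 : Kobayashi2003.thm41_signedCharIdeal_divisibility)
    (h22 : Kobayashi2003.thm22_etaSignedSelmerDual_finite_torsion)
    (h41 : Kobayashi2003.thm41_plusEtaCharIdeal_dvd)
    (hKO : KitajimaOtsuki2018.mainThm13_etaSignedSelmerDual_noFiniteSubmodule)
    (hPT : poitouTate_selmerStructure_duality_real ℚ) (hp5 : 5 ≤ p)
    {Es : List TamLocal} {W₀ : WeierstrassCurve ℤ} (hrow : TamLocal.rowCheck Es W₀ = true)
    (L : List ℕ) (hout : ∀ E ∈ Es, E.p ∉ L → E.p = p ∨ ∀ c ∈ E.vals, ¬ p ∣ c)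
    (hin : ∀ E ∈ Es, E.p ∈ L → E.vals = [E.c] ∧ p ∣ E.c ∧ ¬ p ^ 2 ∣ E.c)
    (hL : ∀ ℓ ∈ L, ℓ ∈ Es.map (·.p)) (hnd : L.Nodup) (hpL : p ∉ L)
    [(W₀.baseChange ℚ).IsElliptic] [hGM : (W₀.baseChange ℚ).IsGloballyMinimal]
    (hdivT : ∀ w ∈ (L.map pl).toFinset, ∀ P : (W₀.baseChange ℚ).toAffine.Point,
      ∃ Q : ((W₀.baseChange ℚ).baseChange (Place.Completion (Sum.inr w : Place ℚ))).toAffine.Point,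
        ((p ^ 1 : ℕ) : ℤ) • Q =
          Affine.Point.baseChange (W' := W₀.baseChange ℚ) ℚ (Place.Completion (Sum.inr w : Place ℚ)) P)
    (V : WeierstrassCurve ℚ) [V.IsElliptic] [V.IsGloballyMinimal] (C : VariableChange ℚ)
    (hCV : C • (W₀.baseChange ℚ).quadraticTwist ((-1) ^ (p / 2) * p) = V)
    (hgood : V.HasGoodReductionAtPrime p) (hap : V.frobeniusTrace p = 0)
    (hsurj : ∀ m : ℕ, V.HasSurjectiveModNGaloisRep (p ^ m : ℕ))
    (hcertV : ∀ {N : ℕ} [NeZero N] (f : CuspForm (Gamma0 N) 2), IsNewformOf V f →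
      ∃ L : IwasawaAlgebra p, Kobayashi2003.IsSignedPAdicLFunction f p 1 L ∧
        IsUnit (PowerSeries.coeff V.mordellWeilRank L))
    (han : ∀ {N : ℕ} [NeZero N] {f : CuspForm (Gamma0 N) 2}, IsNewformOf V f →
      ∀ (ϖ : ℚ), (if Even (p / 2) then (ϖ : ℝ) * V.realPeriodRat = plusPeriod f
          else (ϖ : ℝ) * V.imaginaryPeriodRat = minusPeriod f) →
      ∀ (Lη : IwasawaAlgebra p), IsQuadraticBranchPlusLFunction f p ϖ Lη →
        ¬ (p : ℤ_[p]) ^ (L.length + 1) ∣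
          PowerSeries.coeff (V.quadraticTwist ((-1) ^ (p / 2) * p)).mordellWeilRank Lη) :
    QuadraticBranchPlusEtaLowerInclusionAt V p ∧ QuadraticBranchPlusEtaMainConjectureAt V p := by
  obtain ⟨hpT, hT, hT1, hsum⟩ := TamagawaRoad.tamagawa_inputs_of_rowCheck hrow hGM p L hout hin hL hnd hpL
  rw [TamagawaRoad.pl_eq_primesEquiv_symm p] at hpT hT
  -- the displayed divisibility, read as the vanishing of the localised Kummer classes (part 1 of the road);
  -- the tree's Kummer map carries the classical `DecidableEq ℚ` in `W(ℚ)`'s group law, this file the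
  -- computable one (equal instances, `Subsingleton`): `convert`
  have hn : ((p ^ 1 : ℕ) : ℤ) ≠ 0 := Nat.cast_ne_zero.mpr (pow_ne_zero 1 hp.out.ne_zero)
  have hdiv : ∀ P : geomPoints (W₀.baseChange ℚ), ∃ Q : geomPoints (W₀.baseChange ℚ), ((p ^ 1 : ℕ) : ℤ) • Q = P :=
    (W₀.baseChange ℚ).zsmul_geomPoints_surjective_holds hn
  have hloc : ∀ w ∈ (L.map pl).toFinset, ∀ P : (W₀.baseChange ℚ).toAffine.Point,
      galoisCohomology.localization ((W₀.baseChange ℚ).torsionGaloisModule ((p ^ 1 : ℕ) : ℤ)) (Sum.inr w) 1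
        (kummerMapTorsion (W₀.baseChange ℚ) ((p ^ 1 : ℕ) : ℤ) hdiv P) = 0 := by
    intro w hw P
    obtain ⟨Q, hQ⟩ := hdivT w hw P
    exact TamagawaRoad.localization_kummerMapTorsion_eq_zero_of_divisible (W₀.baseChange ℚ) hn hdiv w P
      ⟨Q, by convert hQ using 3 <;> congr <;> exact Subsingleton.elim _ _⟩
  exact quadraticBranchPlusEta_lowerInclusion_and_mainConjectureAt_of_namedFacts_of_poitouTate_of_tamagawa_of_mordellWeilDivisible
    h12 h13 h22 h41 hKO hPT hp5 hgood hap hsurj (fun f hf => hcertV f hf) (W₀.baseChange ℚ) C hCV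
    ((L.map pl).toFinset) hpT hT 1 le_rfl hT1 hdiv hloc L.length (by rw [hsum]) (fun hf => han hf)

end Shape

/-! ## §2 The row `499800hw1` at `p = 7` -/

namespace PlusEtaR1MordellWeilRows

/-- The kernel ROW CERTIFICATE of `W = 499800hw1` (`[0, 1, 0, -82728, -15314832]`): `2`: II* `n = 11`, kind 5 (deep Tate
certificate), `c = 1`; `3`: I₇ `n = 7`, kind 1 (SPLIT, node-tangent root `2`), `c = 7`; `5`: II `n = 2`, kind 4 (Tate Step-2 certificate),
`c = 1`; `7`: I₀* `n = 6`, kind 5 (deep Tate certificate), `c = 2` (certified set `[1, 2, 4]`); `17`: I₃ `n = 3`, kind 3 (non-split, Euler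
witness), `c = 1`; complete (`|Δ| = 2¹¹·3⁷·5²·7⁶·17³`). Engine `tam.py` (rank-2 observatory, kernel-tam3 engine 1, sha16 27accf42683dbafd)
unmodified, values = PARI `elllocalred`; checked by `decide +kernel`. [cite: SilvermanATAEC1994, IV.9.4] [cite: Cremona1997, Table 1 (label 499800hw1)] -/
theorem rowCheck_v499800hw1 :
    TamLocal.rowCheck [⟨2, 1, 5, 0, 0, 1, 4, 11, 10, 0, 1⟩, ⟨3, 1, 1, 2, 0, 0, 0, 7, 0, 0, 7⟩, ⟨5, 2, 4, 0, 3, 0, 0, 2, 2, 1, 1⟩,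
      ⟨7, 2, 5, 0, 2, 0, 0, 6, 6, 0, 2⟩, ⟨17, 4, 3, 0, 0, 0, 0, 3, 0, 0, 1⟩] ⟨0, 1, 0, -82728, -15314832⟩ = true := by
  decide +kernel

set_option maxRecDepth 100000 in
/-- `W = 499800hw1` (`[0, 1, 0, -82728, -15314832]`) is a GLOBAL MINIMAL equation (bounded Kraus criterion on the literal
coefficients). [cite: Kraus1989] [cite: SilvermanAEC2009, VII.1 Remark 1.1] -/
theorem isGloballyMinimal_v499800hw1 : (⟨0, 1, 0, -82728, -15314832⟩ : WeierstrassCurve ℚ).IsGloballyMinimal :=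
  isGloballyMinimal_of_krausCriterion_bounded 0 1 0 (-82728) (-15314832)
    (by decide +kernel) (by decide +kernel) (by decide +kernel)

/-- **(E⁺_η) ∧ (C1⁺_η) at `p = 7` for EVERY tower-onto good supersingular twist of `W = 499800hw1`** (Cremona's minimal
model `[0, 1, 0, -82728, -15314832]`, `N = 499800 = 7²·10200`, additive I₀* at `7`; its minimal `7*`-twist `V = W^{(−7)}` has conductor
`10200`, good supersingular with `a_7(V) = 0`, `ρ_{V,7^∞}` onto, `r_an = 1` — a RANK-ONE TOWER-ONTO row of crux 19601's census and one
of the four rank-one residue rows of g4; the ONE Tamagawa-`7` prime is `ℓ = 3` (split I₇, `c₃ = 7`), `v_an = 1` in g3's table).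
IN THE KERNEL: `Δ ≠ 0`, global minimality, the local Tamagawa numbers of `W` at every bad prime (`rowCheck_v499800hw1`), hence
`∑_T ord₇ c_ℓ(W) = 1` on `T = {3}` and `7 ∤ c_ℓ(W)` at every other `ℓ ≠ 7`. DISPLAYED: the `7`-divisibility of every rational point of `W`
in `W(ℚ₃)` (`hdiv3`; evidence kit j275435: `W(ℚ) = ℤP`, `P` `7`-saturated of height `4.359…` on the identity component at `3`, `W⁰(ℚ₃)`
uniquely `7`-divisible); on `V`: tower onto, the `V`-certificate, the analytic certificate `49 ∤ coeff₁ L_7⁺(V,η,T)`. CONDITIONAL on the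
named facts; a per-row instance; nothing booked; `BSD(W,7)` not claimed. [cite: Kobayashi2003, §4 Even main conjecture and Thm. 4.1 (p. 8)]
[cite: KitajimaOtsuki2018, Thm. 1.3] [cite: MilneADT2006, Ch. I, Thm. 4.10] [cite: Cremona1997, Table 1 (label 499800hw1)] -/
theorem etaPair_r1_v499800hw1_7
    (h12 : Kobayashi2003.thm12_signedSelmerDual_finite_torsion)
    (h13 : Kobayashi2003.thm41_signedCharIdeal_divisibility)
    (h22 : Kobayashi2003.thm22_etaSignedSelmerDual_finite_torsion)
    (h41 : Kobayashi2003.thm41_plusEtaCharIdeal_dvd)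
    (hKO : KitajimaOtsuki2018.mainThm13_etaSignedSelmerDual_noFiniteSubmodule)
    (hPT : poitouTate_selmerStructure_duality_real ℚ)
    (W : WeierstrassCurve ℚ) (hW : W = ⟨0, 1, 0, -82728, -15314832⟩)
    (hdiv3 : ∀ P : W.toAffine.Point,
      ∃ Q : (W.baseChange (Place.Completion (Sum.inr (pl 3) : Place ℚ))).toAffine.Point,
        ((7 ^ 1 : ℕ) : ℤ) • Q = Affine.Point.baseChange (W' := W) ℚ (Place.Completion (Sum.inr (pl 3) : Place ℚ)) P)
    (V : WeierstrassCurve ℚ) [V.IsElliptic] [V.IsGloballyMinimal] [Fact (7 : ℕ).Prime]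
    (C : VariableChange ℚ) (hCV : C • W.quadraticTwist (-7) = V)
    (hgood : V.HasGoodReductionAtPrime 7) (hap : V.frobeniusTrace 7 = 0)
    (hsurj : ∀ m : ℕ, V.HasSurjectiveModNGaloisRep (7 ^ m : ℕ))
    (hcertV : ∀ {N : ℕ} [NeZero N] (f : CuspForm (Gamma0 N) 2), IsNewformOf V f →
      ∃ L : IwasawaAlgebra 7, Kobayashi2003.IsSignedPAdicLFunction f 7 1 L ∧
        IsUnit (PowerSeries.coeff V.mordellWeilRank L))
    (han : ∀ {N : ℕ} [NeZero N] {f : CuspForm (Gamma0 N) 2}, IsNewformOf V f →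
      ∀ (ϖ : ℚ), (if Even (7 / 2) then (ϖ : ℝ) * V.realPeriodRat = plusPeriod f
          else (ϖ : ℝ) * V.imaginaryPeriodRat = minusPeriod f) →
      ∀ (Lη : IwasawaAlgebra 7), IsQuadraticBranchPlusLFunction f 7 ϖ Lη →
        ¬ (7 : ℤ_[7]) ^ 2 ∣ PowerSeries.coeff (V.quadraticTwist (-7)).mordellWeilRank Lη) :
    QuadraticBranchPlusEtaLowerInclusionAt V 7 ∧ QuadraticBranchPlusEtaMainConjectureAt V 7 := by
  subst hW
  have hb := IntModelTam.baseChange_rat_mk_int 0 1 0 (-82728) (-15314832)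
  haveI : ((⟨0, 1, 0, -82728, -15314832⟩ : WeierstrassCurve ℤ).baseChange ℚ).IsElliptic :=
    TamLocal.isElliptic_of_rowCheck rowCheck_v499800hw1
  haveI : ((⟨0, 1, 0, -82728, -15314832⟩ : WeierstrassCurve ℤ).baseChange ℚ).IsGloballyMinimal := by
    rw [hb]; exact isGloballyMinimal_v499800hw1
  have hD : ((-1 : ℚ) ^ ((7 : ℕ) / 2) * ((7 : ℕ) : ℚ)) = -7 := by norm_num
  refine etaPair_of_rowCheck_of_mordellWeilDivisible h12 h13 h22 h41 hKO hPT (by norm_num) rowCheck_v499800hw1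
    [3] (by decide) (by decide) (by decide) (by decide) (by decide) ?_ V C
    (by rw [hb, hD]; exact hCV) hgood hap hsurj (fun f hf => hcertV f hf) ?_
  · rw [hb]
    intro w hw P
    have hw3 : w = pl 3 := by simpa using hw
    subst hw3
    exact hdiv3 P
  · intro N _ f hf ϖ hϖ Lη hL
    rw [hD]
    exact han hf ϖ hϖ Lη hL

end PlusEtaR1MordellWeilRows

end Summit.BirchSwinnertonDyer.BirchSwinnertonDyer.Theorems

end
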